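import Summits.BirchSwinnertonDyer.BirchSwinnertonDyer.Theorems.AlignedTransportAtTwoMainConjectureOfRankZeroBSDAtTwoCubicClassNumberParityOfLValue
import Summits.BirchSwinnertonDyer.BirchSwinnertonDyer.Theorems.AlignedTransportAtTwoMainConjectureOfRankZeroBSDAtTwoCubicChevalleyLValueBit
import HarnessLib

/-!
# Route `AlignedTransportAtTwo`, crux C2 `MainConjectureOfRankZeroBSDAtTwo` (stmt-BirchSwinnertonDyer-22298):
# `1 ≤ rank₂ Cl(ℚ(β)) ≤ ord₂(L(W,1)/Ω_W)` on the even-`L`-value branch of the cubic cell, granted `BSD₂(W)` and the two-sided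
# Brumer–Kramer / Yoo–Yu bound; with a `2`-descent certificate `#Sel₂(W/ℚ) = 4`: `rank₂ Cl(ℚ(β)) ∈ {1, 2}`; and the `L`-value-keyed
# cubic door displayed with the ONE two-sided Yoo–Yu fact (`hYY2`) instead of the special-shape `hYY`

HONEST FRAMING (cell `bsd-f1-sign2`, WIDTH-5 attached prover seat `bsd-line-att-p5` gen 30 on line `birth` of the lead `bsd-line-att-p2`;
`--supports` stmt-BirchSwinnertonDyer-22298, closes nothing; BSD is NOT proved by any of this; the crux C2, its verdict «blocked-on
`Rank1Residual.GreenbergMuConjectureIrreducible`» and every registered stub are untouched). THEOREMS ONLY (no definition, no `sorry`); named facts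
DISPLAYED as hypotheses: `yooYu_card_selmerTwo_bounds_cubicTwoTorsionField` (`hYY2`, Yoo–Yu 2022 Thm. 1.6 both bounds), Miller's `BSDp W 2` (the
crux's own `hbsd`), and in §3 the crux's PRINT⁵ + MuIneqʳ verbatim. Sequel of this gen's `…SelmerTwoOfBSDp`, `…CubicChevalleyLValueBit`,
`…CubicClassNumberParityOfLValue`.

WHAT.
* §1 `natCard_sha_torsionBy_two_le_two_pow_of_bsdp`: `BSDp W 2`, `#Ш_an = q`, `ord₂ q = k` ⟹ `#Ш(W)[2] ≤ 2^k` (`Ш[2] ⊆ Ш[2^∞]`, `#Ш[2^∞] = 2^k`);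
  `natCard_selmerTwo_le_two_pow_of_bsdp_of_lValue`: + `r_an = 0`, `ht`, `Odd (∏ c_v)`, `L(W,1)/Ω_W = q` ⟹ `#Sel₂(W/ℚ) ≤ 2^{ord₂ q}`.
* §2 ★ `card_classGroup_quotient_sq_le_two_pow_of_bsdp_of_lValue`: + `hYY2` (+ good ordinary, `Δ_W < 0`) ⟹ **`#(C_L/C_L²) ≤ 2^{ord₂(L(W,1)/Ω_W)}`**,
  i.e. `rank₂ Cl(ℚ(β)) ≤ ord₂(L(W,1)/Ω_W)`; ★ `two_le_and_le_two_pow_card_classGroup_quotient_sq_of_bsdp_of_lValue`: for `ord₂(L/Ω) = k ≠ 0`,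
  **`2 ≤ #(C_L/C_L²) ≤ 2^k`**; ★ `card_classGroup_quotient_sq_mem_of_natCard_selmerTwo_eq_four`: with the `2`-descent certificate `#Sel₂(W/ℚ) = 4`
  (the X5 table's `dim Sel₂ = 2`), **`#(C_L/C_L²) = 2 ∨ #(C_L/C_L²) = 4`** (`rank₂ Cl(ℚ(β)) ∈ {1,2}`) — from `hYY2` alone, no `BSD₂`.
* §3 the `L`-value-keyed off-stratum cubic door of `…CubicChevalleyLValueBit` with `hYY` REPLACED by `hYY2`
  (`…ParityOfLValue.yooYu_selmerTwo_eq_bot_oddClassNumber_of_bounds`): the lineage's cubic road now displays ONE Yoo–Yu fact throughout.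

READING / CENSUS PREDICTION (-data, -imc). X5-AT2-TABLE v1.2: the sub-cell {`type2 = ord`, `r_an = 0`, `#E(ℚ)[2] = 1`, `Δ < 0` (`Q_v2 = Q⁺`),
`v₂(tam) = 0`} has 111 classes, ALL with `v₂(L/Ω) = v₂(#Ш_an) ∈ {4, 6}` (105 / 6) and `dim Sel₂ = 2`. Granted `BSD₂` + `hYY2`, §2 predicts for EVERY
one of them: `rank₂ Cl(ℚ(β)) ∈ {1, 2}` (from `dim Sel₂ = 2` alone, by `hYY2`) — in particular `h(ℚ(β))` EVEN, so neither the `(0,1)` class-number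
certificate nor the Chevalley unit-sign road (both need `2 ∤ h(ℚ(β))`) fires on ANY census class: on the census the cubic road is the RANK-form /
higher-layer branch only. The odd-`L/Ω` branch of C2's cell (unit-sign road) is non-empty but lies outside the X5 census (there BSD₂ is known by
`2`-descent). CONDITIONAL; nothing asserted about any curve; nothing closed; BSD is not proved.

References: [YooYu2022] Thm. 1.4, 1.6, 1.10, 1.11 (1), Remark 2.4; [Miller2011LMS] Def. 1.1; [SilvermanAEC2009] Thm. X.4.2; tree: this gen's
`…SelmerTwoOfBSDp` / `…CubicClassNumberParityOfLValue` / `…CubicChevalleyLValueBit`, att-p5 g29 `…CubicChevalleySelmerBit`.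
-/

set_option linter.dupNamespace false
set_option autoImplicit false

noncomputable section

open scoped Classical NumberField AddSubgroup IntermediateField nonZeroDivisors

namespace Summit.BirchSwinnertonDyer.BirchSwinnertonDyer.Theorems.AlignedTransportAtTwoCubicClassRankBoundsOfLValue

open WeierstrassCurve NumberField Polynomial IntermediateField CongruenceSubgroup
  Literature.NumberTheory.IwasawaTheory Literature.NumberTheory.GaloisRepresentations
  Literature.NumberTheory.EllipticCurves Literature.NumberTheory.EllipticCurves.Greenberg1999
  Literature.NumberTheory.EllipticCurves.ModularForms Literature.NumberTheory.EllipticCurves.Rank1Residual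
  Literature.NumberTheory.EllipticCurves.Module Literature.NumberTheory.EllipticCurves.Zhai2016
  Summit.BirchSwinnertonDyer.Rank1Residual Summit.BirchSwinnertonDyer.Rank1Residual.X1.MuLambda
  Summit.BirchSwinnertonDyer.Rank1Residual.X5 Summit.BirchSwinnertonDyer.Rank1Residual.F1Sign2
  Summit.BirchSwinnertonDyer.BirchSwinnertonDyer.Theorems.Rank1ResidualX1Defs
  Summit.BirchSwinnertonDyer.BirchSwinnertonDyer.Theses.AlignedTransportAtTwo
  Summit.BirchSwinnertonDyer.BirchSwinnertonDyer.Theorems.AlignedTransportAtTwoSelmerTwoOfBSDp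
  Summit.BirchSwinnertonDyer.BirchSwinnertonDyer.Theorems.AlignedTransportAtTwoCubicClassNumberParityOfLValue
  Summit.BirchSwinnertonDyer.BirchSwinnertonDyer.Theorems.AlignedTransportAtTwoCubicChevalleyLValueBit
  Summit.BirchSwinnertonDyer.BirchSwinnertonDyer.Theorems.AlignedTransportAtTwoCubicChevalleySelmerBit

variable (W : WeierstrassCurve ℚ) [W.IsElliptic]

/-! ## §1 Upper bounds from `BSD(W,2)`: `#Ш[2] ≤ #Ш[2^∞] = 2^{ord₂ #Ш_an}`, `#Sel₂ ≤ 2^{ord₂(L/Ω)}` -/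

omit [W.IsElliptic] in
/-- **`BSDp W 2`, `#Ш_an = q`, `ord₂ q = k` ⟹ `#Ш(W)[2^∞] = 2^k`** (Miller's clause; the finite `2`-group `Ш[2^∞]` has order `2^{ord₂ #Ш[2^∞]}`).
[cite: Miller2011LMS, Def. 1.1 (arXiv:1010.2431 p. 3)] -/
theorem natCard_primaryComponent_sha_eq_two_pow_of_bsdp (hbsd : BSDp W 2) {q : ℚ} (hq : shaAn W = (q : ℂ)) {k : ℕ}
    (hk : padicValRat 2 q = k) : Nat.card (AddCommGroup.primaryComponent W.sha 2) = 2 ^ k := by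
  obtain ⟨-, hfin, q', hq', hval⟩ := hbsd
  haveI := hfin
  have hqq : q' = q := by exact_mod_cast hq'.symm.trans hq
  subst hqq
  obtain ⟨n, hn⟩ := exists_card_addPrimaryComponent_eq_pow (A := W.sha) 2
  rw [hn, padicValNat.prime_pow] at hval
  rw [hval] at hk
  have hnk : n = k := by exact_mod_cast hk
  rw [hn, hnk]

omit [W.IsElliptic] in
/-- **`BSDp W 2`, `#Ш_an = q`, `ord₂ q = k` ⟹ `#Ш(W)[2] ≤ 2^k`** (`Ш[2] ⊆ Ш[2^∞]`). [cite: Miller2011LMS, Def. 1.1] -/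
theorem natCard_sha_torsionBy_two_le_two_pow_of_bsdp (hbsd : BSDp W 2) {q : ℚ} (hq : shaAn W = (q : ℂ)) {k : ℕ}
    (hk : padicValRat 2 q = k) : Nat.card (AddSubgroup.torsionBy W.sha (2 : ℕ)) ≤ 2 ^ k := by
  haveI : Finite (AddCommGroup.primaryComponent W.sha 2) := hbsd.2.1
  rw [← natCard_primaryComponent_sha_eq_two_pow_of_bsdp W hbsd hq hk]
  have hsub : ∀ y : W.sha, y ∈ AddSubgroup.torsionBy W.sha (2 : ℕ) → y ∈ AddCommGroup.primaryComponent W.sha 2 := fun y hy =>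
    (AddCommGroup.mem_primaryComponent).mpr ⟨1, by rw [pow_one]; exact AddSubgroup.torsionBy.nsmul_iff.mp hy⟩
  exact Nat.card_le_card_of_injective (fun y => (⟨y.1, hsub y.1 y.2⟩ : AddCommGroup.primaryComponent W.sha 2))
    (fun a b hab => by
      simp only [Subtype.mk.injEq] at hab
      exact Subtype.ext hab)

/-- **`BSDp W 2`, `r_an = 0`, `ht`, `#Ш_an = q`, `ord₂ q = k` ⟹ `#Sel₂(W/ℚ) ≤ 2^k`** (`#Sel₂ = 2^0·#E(ℚ)[2]·#Ш[2]`, Silverman X.4.2).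
[cite: SilvermanAEC2009, Thm. X.4.2] [cite: Miller2011LMS, Def. 1.1] -/
theorem natCard_selmerTwo_le_two_pow_of_bsdp_of_shaAn (hbsd : BSDp W 2) (hr : W.analyticRank = 0)
    (ht : ∀ x : ℚ, ¬ HasRationalTwoTorsionX W x) {q : ℚ} (hq : shaAn W = (q : ℂ)) {k : ℕ} (hk : padicValRat 2 q = k) :
    Nat.card (W.selmerGroup 2) ≤ 2 ^ k := by
  have hr0 : W.mordellWeilRank = 0 := hbsd.1.trans hr
  have hle := natCard_sha_torsionBy_two_le_two_pow_of_bsdp W hbsd hq hk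
  rw [natCard_torsionBy_sha_eq_natCard_sha_inf_torsionBy] at hle
  have h1 := natCard_torsionBy_point_two_eq_one W ht
  have hcard : Nat.card (W.selmerGroup (2 : ℕ)) = 2 ^ W.mordellWeilRank * Nat.card (AddSubgroup.torsionBy W.toAffine.Point (2 : ℕ)) *
      Nat.card (W.sha ⊓ AddSubgroup.torsionBy W.galH1 (2 : ℕ) : AddSubgroup W.galH1) := by
    convert W.natCard_selmerGroup_eq (n := 2) two_ne_zero
  rw [hr0, pow_zero, one_mul, h1, one_mul] at hcard
  rw [← hcard] at hle
  exact hle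

/-- **The `L`-value form**: `BSDp W 2`, `r_an = 0`, `ht`, `Odd (∏ c_v)`, `L(W,1)/Ω_W = q`, `ord₂ q = k` ⟹ `#Sel₂(W/ℚ) ≤ 2^k`
(`ord₂ #Ш_an = ord₂ (L(W,1)/Ω_W)` for odd `#E(ℚ)_tors`, `∏ c_v`). [cite: SilvermanAEC2009, Thm. X.4.2] [cite: Miller2011LMS, §1 and Def. 1.1] -/
theorem natCard_selmerTwo_le_two_pow_of_bsdp_of_lValue (hbsd : BSDp W 2) (hr : W.analyticRank = 0)
    (ht : ∀ x : ℚ, ¬ HasRationalTwoTorsionX W x) (htam : Odd W.tamagawaProduct) {q : ℚ}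
    (hL : W.entireLFunction 1 / (W.realPeriodRat : ℂ) = (q : ℂ)) {k : ℕ} (hk : padicValRat 2 q = k) :
    Nat.card (W.selmerGroup 2) ≤ 2 ^ k := by
  have hr0 : W.mordellWeilRank = 0 := hbsd.1.trans hr
  rcases eq_or_ne q 0 with hq0 | hq0
  · -- `q = 0`: then `k = 0`, `#Ш_an = 0` has `ord₂ = 0`, and `Sel₂ = ⊥`
    subst hq0
    have hk0 : k = 0 := by rw [padicValRat.zero] at hk; exact_mod_cast hk.symm
    have hsha := shaAn_eq_of_analyticRank_eq_zero_of_lValue W hr0 hr hL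
    rw [zero_mul, zero_div] at hsha
    exact natCard_selmerTwo_le_two_pow_of_bsdp_of_shaAn W hbsd hr ht hsha (by rw [padicValRat.zero, hk0]; rfl)
  · refine natCard_selmerTwo_le_two_pow_of_bsdp_of_shaAn W hbsd hr ht (shaAn_eq_of_analyticRank_eq_zero_of_lValue W hr0 hr hL) ?_
    rw [padicValRat_shaAn_eq_of_lValue W 2 (irr_two_of_forall_not_hasRationalTwoTorsionX W ht)
      (not_two_dvd_tamagawaProduct_of_odd W htam) hq0, hk]

/-! ## §2 ★ `1 ≤ rank₂ Cl(ℚ(β)) ≤ ord₂(L(W,1)/Ω_W)` granted `BSD₂(W)` + the two-sided Yoo–Yu bound -/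

section ClassGroup

variable [W.IsGloballyMinimal]

/-- **★ `rank₂ Cl(ℚ(β)) ≤ ord₂(L(W,1)/Ω_W)`**: for `W/ℚ` globally minimal, good ordinary at `2`, no rational `2`-torsion abscissa, `Δ_W < 0`,
`Odd (∏_v c_v)`, `r_an = 0`, granted `BSD₂(W)` + `hYY2`: if `L(W,1)/Ω_W = q` with `ord₂ q = k` then `#(C_L/C_L²) ≤ 2^k` for `L = ℚ(β)`.
[cite: YooYu2022, Thm. 1.6 with Thm. 1.4 / 1.10 / 1.11 (1)] [cite: Miller2011LMS, Def. 1.1] [cite: SilvermanAEC2009, Thm. X.4.2] -/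
theorem card_classGroup_quotient_sq_le_two_pow_of_bsdp_of_lValue (hYY2 : yooYu_card_selmerTwo_bounds_cubicTwoTorsionField)
    (hord : IsOrdinaryAt W 2) (ht : ∀ x : ℚ, ¬ HasRationalTwoTorsionX W x) (hΔ : W.Δ < 0) (htam : Odd W.tamagawaProduct)
    (hr : W.analyticRank = 0) (hbsd : BSDp W 2) {q : ℚ}
    (hL : W.entireLFunction 1 / (W.realPeriodRat : ℂ) = (q : ℂ)) {k : ℕ} (hk : padicValRat 2 q = k)
    {β : AlgebraicClosure ℚ} (hβ : aeval β W.twoTorsionPolynomial.toPoly = 0) :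
    Nat.card (ClassGroup (𝓞 ↥(IntermediateField.adjoin ℚ ({β} : Set (AlgebraicClosure ℚ)))) ⧸
        (powMonoidHom 2 : ClassGroup (𝓞 ↥(IntermediateField.adjoin ℚ ({β} : Set (AlgebraicClosure ℚ)))) →* _).range) ≤ 2 ^ k := by
  obtain ⟨hlow, -⟩ := hYY2 W hord ht hΔ htam hβ
  exact hlow.trans (natCard_selmerTwo_le_two_pow_of_bsdp_of_lValue W hbsd hr ht htam hL hk)

/-- **★ THE SANDWICH ON THE EVEN-`L`-VALUE BRANCH**: same cell, `L(W,1)/Ω_W = q` with `ord₂ q = k ≠ 0` ⟹ **`2 ≤ #(C_L/C_L²) ≤ 2^k`**, i.e.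
`1 ≤ rank₂ Cl(ℚ(β)) ≤ k`. (`2045b1`, `27735d1`: `k = 4`; the 111 X5 classes of the sub-cell: `k ∈ {4, 6}`.)
[cite: YooYu2022, Thm. 1.6 with Thm. 1.4 / 1.10 / 1.11 (1)] [cite: Miller2011LMS, Def. 1.1] [cite: SilvermanAEC2009, Thm. X.4.2 and X.4.14] -/
theorem two_le_and_le_two_pow_card_classGroup_quotient_sq_of_bsdp_of_lValue
    (hYY2 : yooYu_card_selmerTwo_bounds_cubicTwoTorsionField)
    (hord : IsOrdinaryAt W 2) (ht : ∀ x : ℚ, ¬ HasRationalTwoTorsionX W x) (hΔ : W.Δ < 0) (htam : Odd W.tamagawaProduct)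
    (hr : W.analyticRank = 0) (hbsd : BSDp W 2) {q : ℚ}
    (hL : W.entireLFunction 1 / (W.realPeriodRat : ℂ) = (q : ℂ)) {k : ℕ} (hk : padicValRat 2 q = k) (hk0 : k ≠ 0)
    {β : AlgebraicClosure ℚ} (hβ : aeval β W.twoTorsionPolynomial.toPoly = 0) :
    2 ≤ Nat.card (ClassGroup (𝓞 ↥(IntermediateField.adjoin ℚ ({β} : Set (AlgebraicClosure ℚ)))) ⧸
        (powMonoidHom 2 : ClassGroup (𝓞 ↥(IntermediateField.adjoin ℚ ({β} : Set (AlgebraicClosure ℚ)))) →* _).range) ∧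
      Nat.card (ClassGroup (𝓞 ↥(IntermediateField.adjoin ℚ ({β} : Set (AlgebraicClosure ℚ)))) ⧸
        (powMonoidHom 2 : ClassGroup (𝓞 ↥(IntermediateField.adjoin ℚ ({β} : Set (AlgebraicClosure ℚ)))) →* _).range) ≤ 2 ^ k := by
  refine ⟨?_, card_classGroup_quotient_sq_le_two_pow_of_bsdp_of_lValue W hYY2 hord ht hΔ htam hr hbsd hL hk hβ⟩
  obtain ⟨-, hup⟩ := hYY2 W hord ht hΔ htam hβ
  have hv : padicValRat 2 q ≠ 0 := by rw [hk]; exact_mod_cast hk0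
  have h4 := four_le_natCard_selmerTwo_of_bsdp_of_lValue W hbsd hr ht htam hL hv
  omega

/-- **★ WITH A `2`-DESCENT CERTIFICATE `#Sel₂(W/ℚ) = 4`** (the X5 table's `dim Sel₂ = 2`): on the cell {globally minimal, good ordinary at `2`,
no rational `2`-torsion abscissa, `Δ_W < 0`, `Odd (∏ c_v)`}, granted `hYY2` alone (no `BSD₂`, no `L`-value): `#(C_L/C_L²) = 2` or `4`, i.e.
**`rank₂ Cl(ℚ(β)) ∈ {1, 2}`** — the census prediction for all 111 sub-cell classes. [cite: YooYu2022, Thm. 1.6 with Thm. 1.4 / 1.10 / 1.11 (1)] -/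
theorem card_classGroup_quotient_sq_mem_of_natCard_selmerTwo_eq_four (hYY2 : yooYu_card_selmerTwo_bounds_cubicTwoTorsionField)
    (hord : IsOrdinaryAt W 2) (ht : ∀ x : ℚ, ¬ HasRationalTwoTorsionX W x) (hΔ : W.Δ < 0) (htam : Odd W.tamagawaProduct)
    (hSel : Nat.card (W.selmerGroup 2) = 4)
    {β : AlgebraicClosure ℚ} (hβ : aeval β W.twoTorsionPolynomial.toPoly = 0) :
    Nat.card (ClassGroup (𝓞 ↥(IntermediateField.adjoin ℚ ({β} : Set (AlgebraicClosure ℚ)))) ⧸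
        (powMonoidHom 2 : ClassGroup (𝓞 ↥(IntermediateField.adjoin ℚ ({β} : Set (AlgebraicClosure ℚ)))) →* _).range) = 2 ∨
      Nat.card (ClassGroup (𝓞 ↥(IntermediateField.adjoin ℚ ({β} : Set (AlgebraicClosure ℚ)))) ⧸
        (powMonoidHom 2 : ClassGroup (𝓞 ↥(IntermediateField.adjoin ℚ ({β} : Set (AlgebraicClosure ℚ)))) →* _).range) = 4 := by
  have hβint : IsIntegral ℚ β := ((AlgebraicClosure.isAlgebraic ℚ).isAlgebraic β).isIntegral
  haveI : FiniteDimensional ℚ ↥(IntermediateField.adjoin ℚ ({β} : Set (AlgebraicClosure ℚ))) := IntermediateField.adjoin.finiteDimensional hβint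
  haveI : NumberField ↥(IntermediateField.adjoin ℚ ({β} : Set (AlgebraicClosure ℚ))) := NumberField.mk
  obtain ⟨hlow, hup⟩ := hYY2 W hord ht hΔ htam hβ
  rw [hSel] at hlow hup
  -- `#(C_L/C_L²)` is a power of `2` (an elementary abelian `2`-group): `2 ≤ c ≤ 4` and `c ∣`-free argument via the `2`-power shape
  set c := Nat.card (ClassGroup (𝓞 ↥(IntermediateField.adjoin ℚ ({β} : Set (AlgebraicClosure ℚ)))) ⧸
        (powMonoidHom 2 : ClassGroup (𝓞 ↥(IntermediateField.adjoin ℚ ({β} : Set (AlgebraicClosure ℚ)))) →* _).range) with hc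
  -- the quotient by the squares has exponent `2`, hence is a `2`-group, hence has `2`-power order
  have hpow : ∃ n : ℕ, c = 2 ^ n := by
    haveI : Fact (Nat.Prime 2) := ⟨Nat.prime_two⟩
    have hG : IsPGroup 2 (ClassGroup (𝓞 ↥(IntermediateField.adjoin ℚ ({β} : Set (AlgebraicClosure ℚ)))) ⧸
        (powMonoidHom 2 : ClassGroup (𝓞 ↥(IntermediateField.adjoin ℚ ({β} : Set (AlgebraicClosure ℚ)))) →* _).range) := by
      intro x
      refine ⟨1, ?_⟩
      induction x using QuotientGroup.induction_on with
      | H g =>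
        rw [pow_one, ← QuotientGroup.mk_pow, QuotientGroup.eq_one_iff]
        exact ⟨g, rfl⟩
    exact IsPGroup.iff_card.mp hG
  obtain ⟨n, hn⟩ := hpow
  rw [hn] at hlow hup ⊢
  have hn1 : 1 ≤ n := by
    by_contra h0
    have : n = 0 := by omega
    rw [this] at hup; norm_num at hup
  have hn2 : n ≤ 2 := by
    by_contra h3
    have h8 : 2 ^ 3 ≤ 2 ^ n := Nat.pow_le_pow_right (by norm_num) (by omega)
    omega
  interval_cases n <;> simp

end ClassGroup

/-! ## §3 The `L`-value-keyed cubic door with the ONE two-sided Yoo–Yu fact (`hYY2`) -/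

section Door

variable [W.IsGloballyMinimal]

/-- **THE OFF-STRATUM CUBIC DOOR INTO `MC₂(W)`, KEYED BY ONE ODD `L`-VALUE, displaying `hYY2`** (the two-sided Yoo–Yu fact) in place of the
special-shape `hYY`: PRINT⁵ + `hYY2` + MuIneqʳ + the crux's cell binders (`hord`, `ht`, `hΔ`, `hr`, `hμan`, `hbsd`) + OFF the stratum + `Odd (∏ c_v)` +
`L(W,1)/Ω_W = q ≠ 0`, `ord₂ q = 0` + integer unit certificates ⟹ `MC₂(W)`. [cite: YooYu2022, Thm. 1.6 with Thm. 1.4 / 1.10 / 1.11 (1)]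
[cite: Kato2004Asterisque, Thm. 17.4 (1)(2) (p. 273)] [cite: GreenbergLNM1716, Thm. 4.1 (p. 102) and Conj. 1.11 (p. 58)] [cite: Miller2011LMS, Def. 1.1]
[cite: Fukuda1994, Thm. 1 (1), p. 264] [cite: Lang1990, Ch. 13 §4, Lemma 4.1] [cite: Serre1973, Ch. III §1.2 Thm. 1] -/
theorem mazurMainConjecture_two_of_muIneqRel_of_lValue_unit_of_unitCerts_of_bounds
    (h17 : ∀ [NeZero (W.conductorNorm ℤ)] (f : CuspForm (Gamma0 (W.conductorNorm ℤ)) 2),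
      kato_divisibility_allPrimes W 2 (f := f))
    (hGr : Greenberg1999.thm41_charValue_rankZero_anyPrime)
    (hper : realPeriodRat_eq_unit_mul_plusPeriod_two) (hmod : nonempty_modularParametrizationData)
    (hGZK : rank_eq_analyticRank_of_analyticRank_le_one)
    (hYY2 : yooYu_card_selmerTwo_bounds_cubicTwoTorsionField)
    (hI : ∀ (W : WeierstrassCurve ℚ) [W.IsElliptic] [W.IsGloballyMinimal], IsOrdinaryAt W 2 →
      (∀ x : ℚ, ¬ HasRationalTwoTorsionX W x) →
      ∀ (κ : ZpExtension ℚ 2) (γ : Field.absoluteGaloisGroup ℚ), κ.IsCyclotomic →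
      κ.IsTopGenerator γ → IsCyclotomicVariable 2 γ →
      ∀ ⦃N : ℕ⦄ [NeZero N] (f : CuspForm (Gamma0 N) 2), IsNewformOf W f →
      ∀ Gp : IwasawaAlgebra 2, iwasawaToPowerSeries 2 Gp = padicLFunction f (unitRoot W 2 : ℚ_[2]) →
      ∀ (D : W.SelmerDualData κ γ) (Yr : W.FineSelmerDualDataRelaxedInf κ γ),
        lengthAt (IwasawaAlgebra 2) D.X ⟨IwasawaAlgebra.augIdealP 2, IwasawaAlgebra.isPrime_augIdealP_holds 2⟩ ≤
          lengthAt (IwasawaAlgebra 2) (IwasawaAlgebra 2 ⧸ Ideal.span {Gp})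
              ⟨IwasawaAlgebra.augIdealP 2, IwasawaAlgebra.isPrime_augIdealP_holds 2⟩ +
            lengthAt (IwasawaAlgebra 2) Yr.X ⟨IwasawaAlgebra.augIdealP 2, IwasawaAlgebra.isPrime_augIdealP_holds 2⟩)
    (hord : IsOrdinaryAt W 2) (ht : ∀ x : ℚ, ¬ HasRationalTwoTorsionX W x) (hΔ : W.Δ < 0) (hr : W.analyticRank = 0)
    (hμan : ∀ ⦃N : ℕ⦄ [NeZero N] (f : CuspForm (Gamma0 N) 2), IsNewformOf W f →
      ∀ G : IwasawaAlgebra 2, IsEvenBranchLiftAtTwo W f G → red G ≠ 0)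
    (hbsd : BSDp W 2) (hs : ¬ OnKilfordStratumAtTwo W) (htam : Odd W.tamagawaProduct)
    (hL : ∃ q : ℚ, q ≠ 0 ∧ W.entireLFunction 1 / (W.realPeriodRat : ℂ) = (q : ℂ) ∧ padicValRat 2 q = 0)
    {β : AlgebraicClosure ℚ} (hβ : aeval β W.twoTorsionPolynomial.toPoly = 0)
    (P : ℤ[X]) (k : ℕ) (m m' a c T S sgn : ℤ) (hsgn : sgn = 1 ∨ sgn = -1)
    (hid : (aeval (4 * (AdjoinSimple.gen ℚ β : ↥(IntermediateField.adjoin ℚ ({β} : Set (AlgebraicClosure ℚ)))))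
          (P.map (Int.castRingHom ℚ)) / (2 ^ k * (m : ↥(IntermediateField.adjoin ℚ ({β} : Set (AlgebraicClosure ℚ)))))) ^ 3
        - T * (aeval (4 * (AdjoinSimple.gen ℚ β : ↥(IntermediateField.adjoin ℚ ({β} : Set (AlgebraicClosure ℚ)))))
          (P.map (Int.castRingHom ℚ)) / (2 ^ k * (m : ↥(IntermediateField.adjoin ℚ ({β} : Set (AlgebraicClosure ℚ)))))) ^ 2
        + S * (aeval (4 * (AdjoinSimple.gen ℚ β : ↥(IntermediateField.adjoin ℚ ({β} : Set (AlgebraicClosure ℚ)))))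
          (P.map (Int.castRingHom ℚ)) / (2 ^ k * (m : ↥(IntermediateField.adjoin ℚ ({β} : Set (AlgebraicClosure ℚ))))))
        - sgn = 0)
    (hc : c = 3 ∨ c = 5) (ha : Odd a)
    (hroot : (2 : ℤ) ^ (k + 3) ∣
      a ^ 3 + (integralModelInt W).b₂ * a ^ 2 + 8 * (integralModelInt W).b₄ * a + 16 * (integralModelInt W).b₆)
    (hmm : ((m * m' : ℤ) : ZMod (2 ^ 3)) = 1)
    (hcert : ((P.eval a * m' : ℤ) : ZMod (2 ^ (k + 3))) = ((2 ^ k * c : ℤ) : ZMod (2 ^ (k + 3)))) :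
    MazurMainConjecture W 2 :=
  mazurMainConjecture_two_of_muIneqRel_of_lValue_unit_of_unitCerts_of_not_onKilfordStratumAtTwo W h17 hGr hper hmod hGZK
    (yooYu_selmerTwo_eq_bot_oddClassNumber_of_bounds hYY2) hI hord ht hΔ hr hμan hbsd hs htam hL hβ P k m m' a c T S sgn hsgn hid hc ha
    hroot hmm hcert

/-- **The same door, `hμan`-FREE, displaying `hYY2`.** [cite: YooYu2022, Thm. 1.6 with Thm. 1.4 / 1.10 / 1.11 (1)] [cite: Kato2004Asterisque, Thm. 17.4 (1)(2) (p. 273)]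
[cite: GreenbergLNM1716, Thm. 4.1 (p. 102)] [cite: Miller2011LMS, Def. 1.1] [cite: Fukuda1994, Thm. 1 (1), p. 264] [cite: Lang1990, Ch. 13 §4, Lemma 4.1] -/
theorem mazurMainConjecture_two_of_muIneqRel_of_lValue_unit_of_unitCerts_of_bounds_muFree
    (h17 : ∀ [NeZero (W.conductorNorm ℤ)] (f : CuspForm (Gamma0 (W.conductorNorm ℤ)) 2),
      kato_divisibility_allPrimes W 2 (f := f))
    (hGr : Greenberg1999.thm41_charValue_rankZero_anyPrime)
    (hper : realPeriodRat_eq_unit_mul_plusPeriod_two) (hmod : nonempty_modularParametrizationData)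
    (hGZK : rank_eq_analyticRank_of_analyticRank_le_one)
    (hYY2 : yooYu_card_selmerTwo_bounds_cubicTwoTorsionField)
    (hI : ∀ (W : WeierstrassCurve ℚ) [W.IsElliptic] [W.IsGloballyMinimal], IsOrdinaryAt W 2 →
      (∀ x : ℚ, ¬ HasRationalTwoTorsionX W x) →
      ∀ (κ : ZpExtension ℚ 2) (γ : Field.absoluteGaloisGroup ℚ), κ.IsCyclotomic →
      κ.IsTopGenerator γ → IsCyclotomicVariable 2 γ →
      ∀ ⦃N : ℕ⦄ [NeZero N] (f : CuspForm (Gamma0 N) 2), IsNewformOf W f →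
      ∀ Gp : IwasawaAlgebra 2, iwasawaToPowerSeries 2 Gp = padicLFunction f (unitRoot W 2 : ℚ_[2]) →
      ∀ (D : W.SelmerDualData κ γ) (Yr : W.FineSelmerDualDataRelaxedInf κ γ),
        lengthAt (IwasawaAlgebra 2) D.X ⟨IwasawaAlgebra.augIdealP 2, IwasawaAlgebra.isPrime_augIdealP_holds 2⟩ ≤
          lengthAt (IwasawaAlgebra 2) (IwasawaAlgebra 2 ⧸ Ideal.span {Gp})
              ⟨IwasawaAlgebra.augIdealP 2, IwasawaAlgebra.isPrime_augIdealP_holds 2⟩ +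
            lengthAt (IwasawaAlgebra 2) Yr.X ⟨IwasawaAlgebra.augIdealP 2, IwasawaAlgebra.isPrime_augIdealP_holds 2⟩)
    (hord : IsOrdinaryAt W 2) (ht : ∀ x : ℚ, ¬ HasRationalTwoTorsionX W x) (hΔ : W.Δ < 0) (hr : W.analyticRank = 0)
    (hbsd : BSDp W 2) (hs : ¬ OnKilfordStratumAtTwo W) (htam : Odd W.tamagawaProduct)
    (hL : ∃ q : ℚ, q ≠ 0 ∧ W.entireLFunction 1 / (W.realPeriodRat : ℂ) = (q : ℂ) ∧ padicValRat 2 q = 0)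
    {β : AlgebraicClosure ℚ} (hβ : aeval β W.twoTorsionPolynomial.toPoly = 0)
    (P : ℤ[X]) (k : ℕ) (m m' a c T S sgn : ℤ) (hsgn : sgn = 1 ∨ sgn = -1)
    (hid : (aeval (4 * (AdjoinSimple.gen ℚ β : ↥(IntermediateField.adjoin ℚ ({β} : Set (AlgebraicClosure ℚ)))))
          (P.map (Int.castRingHom ℚ)) / (2 ^ k * (m : ↥(IntermediateField.adjoin ℚ ({β} : Set (AlgebraicClosure ℚ)))))) ^ 3
        - T * (aeval (4 * (AdjoinSimple.gen ℚ β : ↥(IntermediateField.adjoin ℚ ({β} : Set (AlgebraicClosure ℚ)))))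
          (P.map (Int.castRingHom ℚ)) / (2 ^ k * (m : ↥(IntermediateField.adjoin ℚ ({β} : Set (AlgebraicClosure ℚ)))))) ^ 2
        + S * (aeval (4 * (AdjoinSimple.gen ℚ β : ↥(IntermediateField.adjoin ℚ ({β} : Set (AlgebraicClosure ℚ)))))
          (P.map (Int.castRingHom ℚ)) / (2 ^ k * (m : ↥(IntermediateField.adjoin ℚ ({β} : Set (AlgebraicClosure ℚ))))))
        - sgn = 0)
    (hc : c = 3 ∨ c = 5) (ha : Odd a)
    (hroot : (2 : ℤ) ^ (k + 3) ∣
      a ^ 3 + (integralModelInt W).b₂ * a ^ 2 + 8 * (integralModelInt W).b₄ * a + 16 * (integralModelInt W).b₆)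
    (hmm : ((m * m' : ℤ) : ZMod (2 ^ 3)) = 1)
    (hcert : ((P.eval a * m' : ℤ) : ZMod (2 ^ (k + 3))) = ((2 ^ k * c : ℤ) : ZMod (2 ^ (k + 3)))) :
    MazurMainConjecture W 2 :=
  mazurMainConjecture_two_of_muIneqRel_of_lValue_unit_of_unitCerts_of_bounds W h17 hGr hper hmod hGZK hYY2 hI hord ht hΔ hr
    (AnalyticMuTwo.red_ne_zero_of_isEvenBranchLiftAtTwo_of_forall_not_hasRationalTwoTorsionX W hord ht) hbsd hs htam hL hβ P k m m' a c T S
    sgn hsgn hid hc ha hroot hmm hcert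

end Door

end Summit.BirchSwinnertonDyer.BirchSwinnertonDyer.Theorems.AlignedTransportAtTwoCubicClassRankBoundsOfLValue

end
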